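import Literature.Analysis.FluidPDE.IsentropicEulerFiniteSpeedOfPropagation
import Literature.MathematicalPhysics.KineticTheory.HardSphereEuler

/-!
# Cone locality for the athermal `5 × 5` Euler system — pointwise algebra and elementary tools

Crux `Summit.AtomisticToContinuum.HydrodynamicLimit.Theses.ImplosionDichotomy.DenseExcursion`
(stmt-AtomisticToContinuum-12586), line `kidder-knob-melnikov`, stub `stub_coneLocality : HsEulerConeLocality`
(the `5 × 5` analogue of `Literature.Analysis.FluidPDE.IsentropicEuler.eqOn_cone_of_eqOn_ball`: domain of
dependence in acoustic cones for the primitive full Euler system of a monatomic fluid with a pressure law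
`p = P Θ ζ(P)`, `∂_P p = Θ γ(P)`). This file holds the pointwise ingredients of Dafermos's energy method
(Hyperbolic Conservation Laws in Continuum Physics, 2nd ed. 2005, proof of Thm 5.2.1) for that system, in which
`ζ, γ ∈ C¹(ℝ)` are ARBITRARY (the link `γ = ζ + id·ζ'` is only needed when the result is specialised):

* `energy_algebra5` — with the RESCALED Friedrichs symmetriser `diag(Θ²γ, P²Θ·1₃, 3P²/2)` (the usual
  `diag(Θγ/P, P, 3P/(2Θ))` multiplied by `PΘ`, so that no division occurs and the energy is polynomial in the
  fields) the time derivative of the relative energy `ẽ = ½(Θ²γ(P)α² + P²Θ|w|² + (3/2)P²β²)` of the difference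
  `(α, w, β)` of two solutions is a transport term, two exact acoustic divergences and an explicit zero-order
  remainder (cf. the torus-global `IsHardSphereEulerSolution.relativeEnergy_balance`);
* `flux_nonpos5` — the lateral boundary flux has the good sign once the cone recedes at speed `≥ ‖U‖ + c_s`,
  `c_s² = Θγ(P) + (2/3)Θζ(P)²`;
* `hasDerivAt_energy5` — the one-variable product rule for `ẽ` along a time line;
* `exists_bound_of_isCompact_of_homogeneous` — a continuous family of `2`-homogeneous functions over a compact
  parameter set is bounded by `M‖v‖²` (this replaces the term-by-term bookkeeping of the zero-order remainder);
* `exists_abs_sub_le_mul_of_contDiff` — a `C¹` function is Lipschitz on `[a, b]`;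
* `exists_contDiff_extension` — a function smooth on an open `J ⊇ [a, b]` agrees near `[a, b]` with a globally
  smooth one (smooth bump; used to reduce `HsEulerConeLocality` to globally smooth laws);
* `isCompact_coneSet`, `cone_of_mem_coneSet`, `mem_coneSet_of_coneWeight_ne_zero` — the support of the smooth
  cone weight `χ(R − ct − (ε² + ‖x − x₀‖²)^{1/2})` over `[0, τ]` is a compact subset of the OPEN cone.

Theorem-only file (no definitions, no named facts).
-/

noncomputable section

open Set Filter MeasureTheory Metric
open scoped Topology ContDiff RealInnerProductSpace

namespace Summit.AtomisticToContinuum.HydrodynamicLimit.Theorems.KidderKnobMelnikov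

namespace ConeLocality

open Literature.Analysis.FluidPDE.IsentropicEuler
open Literature.MathematicalPhysics.KineticTheory (V3)

/-! ### The pointwise energy algebra -/

set_option maxHeartbeats 800000 in
/-- **The energy identity of the `5 × 5` system, pointwise algebra.** At a point where two solutions have values
`(P, U, Θ)`, `(P₂, U₂, Θ₂)`, time derivatives `dP, dU, dΘ, …`, space derivatives `LP, AU, LΘ, …` (gradients
`gP, gΘ, …`) and pressure coefficients `ζᵢ = ζ(Pᵢ)`, `γᵢ = γ(Pᵢ)`, the combination
`Θ²γ₁ α α' + P²Θ ⟨w, w'⟩ + (3/2)P² β β'` (`α = P − P₂`, `w = U − U₂`, `β = Θ − Θ₂`) plus the principal transport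
term plus the two acoustic divergences `PΘ²γ₁(α div w + Dα(w))`, `P²Θζ₁(β div w + Dβ(w))` equals an explicit
zero-order bilinear remainder in `α, w, β, ζ₁ − ζ₂, γ₁ − γ₂`.
[cite: Dafermos2005, §5.2, proof of Thm 5.2.1, (5.2.9)–(5.2.10)] -/
theorem energy_algebra5 : ∀ {ζ₁ ζ₂ γ₁ γ₂ P Θ P₂ Θ₂ dP dΘ dP₂ dΘ₂ : ℝ}
    {U U₂ dU dU₂ gP gΘ gP₂ gΘ₂ : V3} {AU AU₂ : V3 →L[ℝ] V3} {LP LΘ LP₂ LΘ₂ : V3 →L[ℝ] ℝ},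
    (∀ v, ⟪gP, v⟫ = LP v) → (∀ v, ⟪gΘ, v⟫ = LΘ v) → (∀ v, ⟪gP₂, v⟫ = LP₂ v) → (∀ v, ⟪gΘ₂, v⟫ = LΘ₂ v) →
    dP + LP U + P * ∑ i, AU (EuclideanSpace.single i 1) i = 0 →
    P • (dU + AU U) + (Θ * γ₁) • gP + (P * ζ₁) • gΘ = 0 →
    dΘ + LΘ U + 2 / 3 * Θ * ζ₁ * ∑ i, AU (EuclideanSpace.single i 1) i = 0 →
    dP₂ + LP₂ U₂ + P₂ * ∑ i, AU₂ (EuclideanSpace.single i 1) i = 0 →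
    P₂ • (dU₂ + AU₂ U₂) + (Θ₂ * γ₂) • gP₂ + (P₂ * ζ₂) • gΘ₂ = 0 →
    dΘ₂ + LΘ₂ U₂ + 2 / 3 * Θ₂ * ζ₂ * ∑ i, AU₂ (EuclideanSpace.single i 1) i = 0 →
    Θ ^ 2 * γ₁ * (P - P₂) * (dP - dP₂) + P ^ 2 * Θ * ⟪U - U₂, dU - dU₂⟫ +
          3 / 2 * P ^ 2 * (Θ - Θ₂) * (dΘ - dΘ₂) +
        (Θ ^ 2 * γ₁ * (P - P₂) * (LP - LP₂) U + P ^ 2 * Θ * ⟪U - U₂, (AU - AU₂) U⟫ +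
          3 / 2 * P ^ 2 * (Θ - Θ₂) * (LΘ - LΘ₂) U) +
        P * Θ ^ 2 * γ₁ * ((P - P₂) * ∑ i, (AU - AU₂) (EuclideanSpace.single i 1) i +
          (LP - LP₂) (U - U₂)) +
        P ^ 2 * Θ * ζ₁ * ((Θ - Θ₂) * ∑ i, (AU - AU₂) (EuclideanSpace.single i 1) i +
          (LΘ - LΘ₂) (U - U₂)) =
      -(Θ ^ 2 * γ₁ * (P - P₂) * LP₂ (U - U₂)) -
        Θ ^ 2 * γ₁ * (P - P₂) ^ 2 * ∑ i, AU₂ (EuclideanSpace.single i 1) i -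
        P ^ 2 * Θ * ⟪U - U₂, AU₂ (U - U₂)⟫ - P * Θ * (P - P₂) * ⟪U - U₂, AU₂ U₂⟫ -
        P * Θ * ((Θ - Θ₂) * γ₁ + Θ₂ * (γ₁ - γ₂)) * LP₂ (U - U₂) -
        P * Θ * ((P - P₂) * ζ₁ + P₂ * (ζ₁ - ζ₂)) * LΘ₂ (U - U₂) -
        P * Θ * (P - P₂) * ⟪U - U₂, dU₂⟫ -
        3 / 2 * P ^ 2 * (Θ - Θ₂) * LΘ₂ (U - U₂) -
        P ^ 2 * (Θ - Θ₂) * ((Θ - Θ₂) * ζ₁ + Θ₂ * (ζ₁ - ζ₂)) * ∑ i, AU₂ (EuclideanSpace.single i 1) i := by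
  intro ζ₁ ζ₂ γ₁ γ₂ P Θ P₂ Θ₂ dP dΘ dP₂ dΘ₂ U U₂ dU dU₂ gP gΘ gP₂ gΘ₂ AU AU₂ LP LΘ LP₂ LΘ₂ hgP hgΘ hgP₂ hgΘ₂
    hC₁ hM₁ hT₁ hC₂ hM₂ hT₂
  have hgP' : ∀ v, ⟪v, gP⟫ = LP v := fun v => (real_inner_comm gP v).trans (hgP v)
  have hgΘ' : ∀ v, ⟪v, gΘ⟫ = LΘ v := fun v => (real_inner_comm gΘ v).trans (hgΘ v)
  have hgP₂' : ∀ v, ⟪v, gP₂⟫ = LP₂ v := fun v => (real_inner_comm gP₂ v).trans (hgP₂ v)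
  have hgΘ₂' : ∀ v, ⟪v, gΘ₂⟫ = LΘ₂ v := fun v => (real_inner_comm gΘ₂ v).trans (hgΘ₂ v)
  -- scalar forms of the momentum equations, tested against `w = U - U₂`
  have sM₁ : P * ⟪U - U₂, dU⟫ + P * ⟪U - U₂, AU U⟫ + Θ * γ₁ * LP (U - U₂) +
      P * ζ₁ * LΘ (U - U₂) = 0 := by
    have h := congrArg (fun v => ⟪U - U₂, v⟫) hM₁
    simp only [inner_add_right, inner_smul_right, inner_zero_right, hgP', hgΘ'] at h
    linarith
  have sM₂ : P₂ * ⟪U - U₂, dU₂⟫ + P₂ * ⟪U - U₂, AU₂ U₂⟫ + Θ₂ * γ₂ * LP₂ (U - U₂) +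
      P₂ * ζ₂ * LΘ₂ (U - U₂) = 0 := by
    have h := congrArg (fun v => ⟪U - U₂, v⟫) hM₂
    simp only [inner_add_right, inner_smul_right, inner_zero_right, hgP₂', hgΘ₂'] at h
    linarith
  have hsum : ∑ i, (AU - AU₂) (EuclideanSpace.single i 1) i =
      ∑ i, AU (EuclideanSpace.single i 1) i - ∑ i, AU₂ (EuclideanSpace.single i 1) i := by
    rw [← Finset.sum_sub_distrib]
    rfl
  rw [hsum]
  simp only [inner_sub_left, inner_sub_right, map_sub, FunLike.coe_sub, Pi.sub_apply] at sM₁ sM₂ ⊢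
  linear_combination (Θ ^ 2 * γ₁ * (P - P₂)) * hC₁ - (Θ ^ 2 * γ₁ * (P - P₂)) * hC₂ +
    (P * Θ) * sM₁ - (P * Θ) * sM₂ + (3 / 2 * P ^ 2 * (Θ - Θ₂)) * hT₁ -
    (3 / 2 * P ^ 2 * (Θ - Θ₂)) * hT₂

/-- **Sign of the boundary flux for the `5 × 5` system.** If `∂ₜΦ + c‖∇Φ‖ ≤ 0`, `Θ, γ₁ ≥ 0` and
`‖U‖ + c_s ≤ c` with `c_s² = Θγ₁ + (2/3)Θζ₁²`, then
`(∂ₜΦ) ẽ + (∇Φ·U) ẽ + (PΘ²γ₁ α + P²Θζ₁ β)(∇Φ·w) ≤ 0`, `ẽ = ½(Θ²γ₁α² + P²Θ‖w‖² + (3/2)P²β²)`: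
by Cauchy–Schwarz `Θ(Θγ₁α + Pζ₁β)² ≤ c_s²(Θ²γ₁α² + (3/2)P²β²)`, whence `|PΘ²γ₁α + P²Θζ₁β| ‖w‖ ≤ c_s ẽ`.
[cite: Dafermos2005, §5.2, proof of Thm 5.2.1, (5.2.5) and (5.2.13)] -/
theorem flux_nonpos5 {c Φt P Θ γ₁ ζ₁ α β : ℝ} {D : V3 →L[ℝ] ℝ} {U w : V3}
    (hΦ : Φt + c * ‖D‖ ≤ 0) (hΘ : 0 ≤ Θ) (hγ : 0 ≤ γ₁)
    (hc : ‖U‖ + Real.sqrt (Θ * γ₁ + 2 / 3 * Θ * ζ₁ ^ 2) ≤ c) :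
    Φt * (1 / 2 * (Θ ^ 2 * γ₁ * α ^ 2 + P ^ 2 * Θ * ‖w‖ ^ 2 + 3 / 2 * P ^ 2 * β ^ 2)) +
        D U * (1 / 2 * (Θ ^ 2 * γ₁ * α ^ 2 + P ^ 2 * Θ * ‖w‖ ^ 2 + 3 / 2 * P ^ 2 * β ^ 2)) +
      (P * Θ ^ 2 * γ₁ * α + P ^ 2 * Θ * ζ₁ * β) * D w ≤ 0 := by
  set e : ℝ := 1 / 2 * (Θ ^ 2 * γ₁ * α ^ 2 + P ^ 2 * Θ * ‖w‖ ^ 2 + 3 / 2 * P ^ 2 * β ^ 2) with he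
  set S : ℝ := Θ * γ₁ + 2 / 3 * Θ * ζ₁ ^ 2 with hS
  set X : ℝ := P * Θ ^ 2 * γ₁ * α + P ^ 2 * Θ * ζ₁ * β with hX
  have hS0 : 0 ≤ S := by rw [hS]; positivity
  have he0 : 0 ≤ e := by rw [he]; positivity
  -- the Cauchy–Schwarz step: `X² ‖w‖² ≤ S e²`
  have hCS : Θ * (Θ * γ₁ * α + P * ζ₁ * β) ^ 2 ≤ S * (Θ ^ 2 * γ₁ * α ^ 2 + 3 / 2 * P ^ 2 * β ^ 2) := by
    have h : S * (Θ ^ 2 * γ₁ * α ^ 2 + 3 / 2 * P ^ 2 * β ^ 2) - Θ * (Θ * γ₁ * α + P * ζ₁ * β) ^ 2 =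
        Θ * γ₁ * (3 / 2 * (P * β - 2 / 3 * Θ * ζ₁ * α) ^ 2) := by rw [hS]; ring
    nlinarith [mul_nonneg (mul_nonneg hΘ hγ)
      (show (0 : ℝ) ≤ 3 / 2 * (P * β - 2 / 3 * Θ * ζ₁ * α) ^ 2 by positivity)]
  have hX2 : X ^ 2 * ‖w‖ ^ 2 ≤ S * e ^ 2 := by
    have h1 : X ^ 2 * ‖w‖ ^ 2 = P ^ 2 * Θ * (Θ * (Θ * γ₁ * α + P * ζ₁ * β) ^ 2) * ‖w‖ ^ 2 := by
      rw [hX]; ring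
    have h3 : P ^ 2 * Θ * (S * (Θ ^ 2 * γ₁ * α ^ 2 + 3 / 2 * P ^ 2 * β ^ 2)) * ‖w‖ ^ 2 =
        S * ((Θ ^ 2 * γ₁ * α ^ 2 + 3 / 2 * P ^ 2 * β ^ 2) * (P ^ 2 * Θ * ‖w‖ ^ 2)) := by ring
    have h4 : (Θ ^ 2 * γ₁ * α ^ 2 + 3 / 2 * P ^ 2 * β ^ 2) * (P ^ 2 * Θ * ‖w‖ ^ 2) ≤ e ^ 2 := by
      rw [he]
      nlinarith [sq_nonneg (Θ ^ 2 * γ₁ * α ^ 2 + 3 / 2 * P ^ 2 * β ^ 2 - P ^ 2 * Θ * ‖w‖ ^ 2)]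
    calc X ^ 2 * ‖w‖ ^ 2 = _ := h1
      _ ≤ P ^ 2 * Θ * (S * (Θ ^ 2 * γ₁ * α ^ 2 + 3 / 2 * P ^ 2 * β ^ 2)) * ‖w‖ ^ 2 := by gcongr
      _ = _ := h3
      _ ≤ S * e ^ 2 := by gcongr
  have hXw : |X| * ‖w‖ ≤ Real.sqrt S * e := by
    have h1 : (|X| * ‖w‖) ^ 2 ≤ (Real.sqrt S * e) ^ 2 := by
      rw [mul_pow, mul_pow, sq_abs, Real.sq_sqrt hS0]; exact hX2
    exact (pow_le_pow_iff_left₀ (by positivity) (by positivity) two_ne_zero).1 h1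
  have h1 : D U * e ≤ ‖D‖ * ‖U‖ * e := by
    gcongr
    exact (le_abs_self _).trans (by simpa [Real.norm_eq_abs] using D.le_opNorm U)
  have h2 : X * D w ≤ ‖D‖ * (Real.sqrt S * e) := by
    calc X * D w ≤ |X * D w| := le_abs_self _
      _ = |X| * |D w| := abs_mul _ _
      _ ≤ |X| * (‖D‖ * ‖w‖) := by gcongr; simpa [Real.norm_eq_abs] using D.le_opNorm w
      _ = ‖D‖ * (|X| * ‖w‖) := by ring
      _ ≤ ‖D‖ * (Real.sqrt S * e) := by gcongr
  calc Φt * e + D U * e + X * D w ≤ Φt * e + ‖D‖ * ‖U‖ * e + ‖D‖ * (Real.sqrt S * e) := by linarith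
    _ = (Φt + (‖U‖ + Real.sqrt S) * ‖D‖) * e := by ring
    _ ≤ (Φt + c * ‖D‖) * e := by gcongr
    _ ≤ 0 := mul_nonpos_of_nonpos_of_nonneg hΦ he0

/-- **The time derivative of the rescaled relative energy along a time line** (product rule):
`d/dt ½(kα² + m‖w‖² + nβ²) = kαα' + m⟨w, w'⟩ + nββ' + ½(k'α² + m'‖w‖² + n'β²)`. [folklore] -/
theorem hasDerivAt_energy5 {k m n P P₂ Θ Θ₂ : ℝ → ℝ} {U U₂ : ℝ → V3}
    {k' m' n' P' P₂' Θ' Θ₂' : ℝ} {U' U₂' : V3} {t : ℝ}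
    (hk : HasDerivAt k k' t) (hm : HasDerivAt m m' t) (hn : HasDerivAt n n' t)
    (hP : HasDerivAt P P' t) (hP₂ : HasDerivAt P₂ P₂' t) (hΘ : HasDerivAt Θ Θ' t)
    (hΘ₂ : HasDerivAt Θ₂ Θ₂' t) (hU : HasDerivAt U U' t) (hU₂ : HasDerivAt U₂ U₂' t) :
    HasDerivAt (fun s => 1 / 2 * (k s * (P s - P₂ s) ^ 2 + m s * ‖U s - U₂ s‖ ^ 2 + n s * (Θ s - Θ₂ s) ^ 2))
      (k t * (P t - P₂ t) * (P' - P₂') + m t * ⟪U t - U₂ t, U' - U₂'⟫ + n t * (Θ t - Θ₂ t) * (Θ' - Θ₂') +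
        1 / 2 * (k' * (P t - P₂ t) ^ 2 + m' * ‖U t - U₂ t‖ ^ 2 + n' * (Θ t - Θ₂ t) ^ 2)) t := by
  have h := (((hk.mul ((hP.sub hP₂).pow 2)).add (hm.mul (hU.sub hU₂).norm_sq)).add
    (hn.mul ((hΘ.sub hΘ₂).pow 2))).const_mul (1 / 2)
  refine h.congr_deriv ?_
  simp only [Nat.cast_ofNat, Nat.add_one_sub_one, pow_one, Pi.sub_apply, Pi.pow_apply]
  ring

/-! ### Elementary tools -/

/-- **A continuous family of `2`-homogeneous functions over a compact parameter set is quadratically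
bounded:** if `Q : X → E → ℝ` is jointly continuous on `K × E`, `K` compact, and `Q x (s • v) = s² Q x v`, then
`Q x v ≤ M ‖v‖²` on `K × E` (bound `Q` on `K × B̄(0, 1)` and rescale). [folklore] -/
theorem exists_bound_of_isCompact_of_homogeneous {X E : Type*} [TopologicalSpace X]
    [NormedAddCommGroup E] [NormedSpace ℝ E] [ProperSpace E]
    {Q : X → E → ℝ} {K : Set X} (hK : IsCompact K)
    (hQ : ContinuousOn (fun q : X × E => Q q.1 q.2) (K ×ˢ univ))
    (hhom : ∀ x ∈ K, ∀ (s : ℝ) (v : E), Q x (s • v) = s ^ 2 * Q x v) :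
    ∃ M, 0 ≤ M ∧ ∀ x ∈ K, ∀ v, Q x v ≤ M * ‖v‖ ^ 2 := by
  obtain ⟨C, hC⟩ := (hK.prod (isCompact_closedBall (0 : E) 1)).exists_bound_of_continuousOn
    (hQ.mono (prod_mono le_rfl (subset_univ _)))
  refine ⟨max C 0, le_max_right _ _, fun x hx v => ?_⟩
  by_cases hv : v = 0
  · have h0 : Q x 0 = 0 := by
      have h := hhom x hx 0 0
      rw [zero_smul, zero_pow two_ne_zero, zero_mul] at h
      exact h
    rw [hv, h0, norm_zero, zero_pow two_ne_zero, mul_zero]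
  · have hr : 0 < ‖v‖ := norm_pos_iff.2 hv
    have hu : ‖v‖⁻¹ • v ∈ closedBall (0 : E) 1 := by
      rw [mem_closedBall, dist_zero_right, norm_smul, norm_inv, norm_norm, inv_mul_cancel₀ hr.ne']
    have h1 : Q x v = ‖v‖ ^ 2 * Q x (‖v‖⁻¹ • v) := by
      rw [← hhom x hx, smul_smul, mul_inv_cancel₀ hr.ne', one_smul]
    have h2 : Q x (‖v‖⁻¹ • v) ≤ max C 0 :=
      ((le_abs_self _).trans (by simpa [Real.norm_eq_abs] using hC (x, ‖v‖⁻¹ • v) ⟨hx, hu⟩)).trans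
        (le_max_left _ _)
    rw [h1, mul_comm]
    exact mul_le_mul_of_nonneg_right h2 (sq_nonneg _)

/-- A `C¹` function on `ℝ` is Lipschitz on every compact interval `[a, b]` (mean value theorem with the
bound of its continuous derivative on `[a, b]`). [folklore] -/
theorem exists_abs_sub_le_mul_of_contDiff {f : ℝ → ℝ} (hf : ContDiff ℝ 1 f) (a b : ℝ) :
    ∃ L, 0 ≤ L ∧ ∀ r ∈ Icc a b, ∀ r' ∈ Icc a b, |f r - f r'| ≤ L * |r - r'| := by
  obtain ⟨L, hL⟩ := isCompact_Icc.exists_bound_of_continuousOn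
    ((hf.continuous_deriv le_rfl).continuousOn (s := Icc a b))
  refine ⟨max L 0, le_max_right _ _, fun r hr r' hr' => ?_⟩
  have h := (convex_Icc a b).norm_image_sub_le_of_norm_deriv_le
    (fun s _ => (hf.differentiable one_ne_zero s)) (fun s hs => (hL s hs).trans (le_max_left L 0)) hr' hr
  simpa only [Real.norm_eq_abs] using h

/-- **Smooth extension from a neighbourhood of a compact interval.** A function smooth on an open set
`J ⊇ [a, b]` (`a ≤ b`) agrees, on an open neighbourhood of `[a, b]`, with a globally smooth function (multiply by a
smooth bump equal to `1` near `[a, b]` and supported in `J`). [folklore] -/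
theorem exists_contDiff_extension {ζ : ℝ → ℝ} {J : Set ℝ} {a b : ℝ} (hJ : IsOpen J)
    (hζ : ContDiffOn ℝ ∞ ζ J) (hKJ : Icc a b ⊆ J) (hab : a ≤ b) :
    ∃ ζ' : ℝ → ℝ, ContDiff ℝ ∞ ζ' ∧ ∃ O : Set ℝ, IsOpen O ∧ Icc a b ⊆ O ∧ EqOn ζ' ζ O := by
  set c : ℝ := (a + b) / 2 with hc
  set r : ℝ := (b - a) / 2 with hr
  have hr0 : 0 ≤ r := by rw [hr]; linarith
  have hK : Icc a b = closedBall c r := by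
    rw [Real.closedBall_eq_Icc, hc, hr]; congr 1 <;> ring
  obtain ⟨δ, hδ, hthick⟩ := isCompact_Icc.exists_thickening_subset_open hJ hKJ
  let f : ContDiffBump c := ⟨r + δ / 4, r + δ / 2, by positivity, by linarith⟩
  refine ⟨fun x => f x * ζ x, ?_, ball c (r + δ / 4), isOpen_ball, ?_, ?_⟩
  · rw [contDiff_iff_contDiffAt]
    intro x
    by_cases hx : x ∈ J
    · exact f.contDiffAt.mul (hζ.contDiffAt (hJ.mem_nhds hx))
    · have hx' : x ∉ tsupport f := by
        intro h
        rw [f.tsupport_eq] at h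
        have h2 : x ∈ thickening δ (Icc a b) := by
          rw [hK, thickening_closedBall hδ hr0]
          exact closedBall_subset_ball (by show r + δ / 2 < δ + r; linarith) h
        exact hx (hthick h2)
      have h0 : (fun x => f x * ζ x) =ᶠ[𝓝 x] fun _ => 0 := by
        filter_upwards [notMem_tsupport_iff_eventuallyEq.1 hx'] with y hy
        rw [hy, Pi.zero_apply, zero_mul]
      exact (contDiffAt_const (c := (0 : ℝ))).congr_of_eventuallyEq h0
  · rw [hK]
    exact closedBall_subset_ball (by linarith)
  · intro x hx
    show f x * ζ x = ζ x
    rw [f.one_of_mem_closedBall (ball_subset_closedBall hx), one_mul]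

/-! ### The compact support of the cone weight over a time interval -/

/-- The set `{(t, x) : 0 ≤ t ≤ τ, ct + (ε² + ‖x − x₀‖²)^{1/2} ≤ R}` (which carries the cone weight over
`[0, τ]`) is compact (`c ≥ 0`: it is closed and contained in `[0, τ] × B̄(x₀, R)`). [folklore] -/
theorem isCompact_coneSet {ε c R τ : ℝ} {x₀ : V3} (hc : 0 ≤ c) :
    IsCompact {p : ℝ × V3 | p.1 ∈ Icc 0 τ ∧ c * p.1 + Real.sqrt (ε ^ 2 + ‖p.2 - x₀‖ ^ 2) ≤ R} := by
  refine ((isCompact_Icc : IsCompact (Icc (0 : ℝ) τ)).prod (isCompact_closedBall x₀ R)).of_isClosed_subset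
    ?_ ?_
  · have h1 : IsClosed {p : ℝ × V3 | p.1 ∈ Icc 0 τ} := isClosed_Icc.preimage continuous_fst
    have h2 : IsClosed {p : ℝ × V3 | c * p.1 + Real.sqrt (ε ^ 2 + ‖p.2 - x₀‖ ^ 2) ≤ R} :=
      isClosed_le (by fun_prop) continuous_const
    exact h1.inter h2
  · rintro p ⟨hp1, hp2⟩
    refine ⟨hp1, ?_⟩
    rw [mem_closedBall, dist_eq_norm]
    have h1 := norm_le_sqrt_sq_add ε (p.2 - x₀)
    nlinarith [mul_nonneg hc hp1.1]

/-- Points of the cone set lie in the OPEN cone `‖x − x₀‖ + ct < R` (`ε ≠ 0`). [folklore] -/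
theorem cone_of_mem_coneSet {ε c R τ : ℝ} {x₀ : V3} (hε : ε ≠ 0) {p : ℝ × V3}
    (hp : p ∈ {p : ℝ × V3 | p.1 ∈ Icc 0 τ ∧ c * p.1 + Real.sqrt (ε ^ 2 + ‖p.2 - x₀‖ ^ 2) ≤ R}) :
    ‖p.2 - x₀‖ + c * p.1 < R := by
  obtain ⟨-, hp2⟩ := hp
  have h : ‖p.2 - x₀‖ < Real.sqrt (ε ^ 2 + ‖p.2 - x₀‖ ^ 2) := by
    rw [Real.lt_sqrt (norm_nonneg _)]
    have hε2 : 0 < ε ^ 2 := by positivity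
    linarith
  linarith

/-- Where the cone weight `χ(R − ct − (ε² + ‖x − x₀‖²)^{1/2})` does not vanish and `0 ≤ t ≤ τ`, the point
lies in the cone set. [folklore] -/
theorem mem_coneSet_of_coneWeight_ne_zero {ε c R τ : ℝ} {x₀ : V3} {p : ℝ × V3}
    (h : Real.smoothTransition (R - c * p.1 - Real.sqrt (ε ^ 2 + ‖p.2 - x₀‖ ^ 2)) ≠ 0)
    (ht : p.1 ∈ Icc 0 τ) :
    p ∈ {p : ℝ × V3 | p.1 ∈ Icc 0 τ ∧ c * p.1 + Real.sqrt (ε ^ 2 + ‖p.2 - x₀‖ ^ 2) ≤ R} := by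
  refine ⟨ht, ?_⟩
  have h1 : ¬(R - c * p.1 - Real.sqrt (ε ^ 2 + ‖p.2 - x₀‖ ^ 2) ≤ 0) := fun h' =>
    h (Real.smoothTransition.zero_of_nonpos h')
  linarith

end ConeLocality

end Summit.AtomisticToContinuum.HydrodynamicLimit.Theorems.KidderKnobMelnikov

end
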